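import Summits.CriticalPhenomena.PercolationContinuityZ3.Theorems.Transplant.SkelNeg1ParamsLF
import Summits.CriticalPhenomena.PercolationContinuityZ3.Theorems.Transplant.SkelPhiParaVLocChain
import HarnessLib

/-!
# N1 params, part 5a (O-level, (C) column): THE PHASE-1 LOCALISATION RECORD OF RECORD `Neg.locPrm₁ κ Φ t p D f : ChainPara.LocPrm` — the signed v-rounds over the fine cell
# map (p5-g8 (C-N8) `SkelPhiParaVLocChain` p281170) with every field FIXED DEFINITIONALLY from the reading numerators at the ledger's values, so that the fifteen numeric
# hypotheses of `fine_mem_vlocRegion_of_link` / `fine_mem_vlocCore_succ_of_piece` (`hLa hLb hsLo hsHi hp₁ hz₁ hm₁ hz₂ hz₃ hp₂ hm₂ hz₄ hz hzP hzM`) hold BY NAME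

builds on p205010 (kernel theorem, internal audit signed; external expert review pending) — nothing in this file uses p205010; NOTHING is claimed about
the node `SamePDropOfSkeletonNeg₁` (OPEN).
Status sentence (coordinator 2026-08-20T04:30Z): "θ(p_c) = 0 on ℤ^d, all d ≥ 2 — kernel-verified (Lean 4/Mathlib, standard axioms); internal adversarial
audit SIGNED 2026-08-20 04:29Z; external expert review pending."
Lane `prim-bschramm-*`, seat `prim-bschramm-stmt` (gen 13); helper file (`--supports stmt-CriticalPhenomena-4575 --as helper`); ledger HOME/prim-bschramm-stmt/NEG-PARAMS.md v0.9 §1C;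
p5-g8 2026-08-21T14:36:27Z (binder list) and 15:15:39Z (answer: `z` is the O(1) floor slack; `e := z + R′`; `W := max (3r₀) (max Pp Pm + z)`; `L0 := 3r₁`; `N` by the formula).
THE VALUES (fine units; `c₀ := 20K(m₀−1)`, `c₁ := 20K(m₁−1)` = the resolutions of `Neg.fcells`, `A := 800`, `D := Dof`, `(n,h,ℓ,vα) :=` the long data, `vβ := vβOf`, `m := modulus`,
`v := v_L`, `β_lo := nℓ − (n+|h|) + 1`, `β_hi := nℓ`, reading term `Trd x B := ⌊c₀·(800·(m·x − B)/n)/D⌋`):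
`sHi := ⌊c₁·800·β_hi/D⌋ + 1`, `sLo := ⌊c₁·800·β_lo/D⌋ − 1`, `Pp := max (Trd n (min …) + 1) (−Trd (−n) (max′ …))`, `Pm := max (−Trd (−n) (max …)) (Trd n (min′ …) + 1)`,
`z := max {Trd v (min …) + 1, Trd (−v) (min′ …) + 1, −Trd v (max …), −Trd (−v) (max′ …)}` (′ = the mirrored layer `[−β_hi, −β_lo]`), **`e := z + R′`**, `W := max (3r₀) (max Pp Pm + z)`,
`La := max sHi (⌊c₁·800·3β_hi/D⌋ + 1)`, `Lb := ⌊c₀·800·(|m|·n + |vα|·3β_hi)/(n·D)⌋ + 1`, `L0 := 3r₁`, `N := ⌊(3r₁ − sHi)/(sLo − e)⌋₊ + 1`.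
* §1 the reading terms and the record **`Neg.locPrm₁`**; §2 the fifteen hypotheses by name (`hLa_at … hzM_at`), §3 the definitional `LocOK` fields `hs/hsL/hPp/hPm` and `hN` shape;
  the two ESTIMATE fields `LocOK.hs0` (`0 ≤ sLo`) and `LocOK.he` (`e ≤ sLo`: kit depth + slack < cells per v-stride) and the Q-rooms are part 5b (they need `|h_L| ≤ 10·n_L` and the
  size of `m_i`, not only the floors).
[cite: KozmaNitzan2024, §4 Lemma 11 (pp. 22–23), Lemma 12 (pp. 23–25)] [cite: MartineauTassion2017, §4.3 Lemma 4.2]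
-/

noncomputable section

open scoped Classical

namespace Summit.CriticalPhenomena.PercolationContinuityZ3.Theorems.Transplant

namespace PlanarSkeletonNeg

namespace Neg

open Literature.Probability.Percolation Literature.Probability.LatticeModels SimpleGraph
open SkelConc (Consts)
open TwoAxis.Para (modulus)

section CorrLevel

variable (κ : Consts) {V : Type} [DecidableEq V] [Countable V] {G : SimpleGraph V} [G.LocallyFinite] (Φ : PlanarSkeletonNeg G) (t : V)
  (p : unitInterval) (D : Skelφ.StepI.DataN V) (f : ℕ)

/-! ## §1 The reading terms and the record -/

/-- The resolution of axis `0`: `c₀ := 20·K·(m₀ − 1)` (`fcells`). [this work] -/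
def c0 : ℤ := 20 * ((fcells κ Φ t p D f).K : ℤ) * (((fcells κ Φ t p D f).s 0 : ℕ) : ℤ)

/-- The resolution of axis `1`: `c₁ := 20·K·(m₁ − 1)` (`fcells`). [this work] -/
def c1 : ℤ := 20 * ((fcells κ Φ t p D f).K : ℤ) * (((fcells κ Φ t p D f).s 1 : ℕ) : ℤ)

/-- The determinant `D := Dof n_L h_L ℓ_L v_L`. [this work] -/
def Dd : ℤ := Skelφ.NegPrm.Dof (nL κ Φ t p D f) (hL κ Φ t p D f) (ℓL κ Φ t p D f) (vL κ Φ t p D f)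

/-- The modulus `m := n·v_β − h·v_α` of the long lattice. [this work] -/
def md : ℤ := modulus (nL κ Φ t p D f) (hL κ Φ t p D f) (vL κ Φ t p D f) (vβL κ Φ t p D f)

/-- The lower edge of the top layer `β_lo := nℓ − (n + |h|) + 1`. [this work] -/
def βlo : ℤ := (nL κ Φ t p D f : ℤ) * ℓL κ Φ t p D f - (nL κ Φ t p D f + (hL κ Φ t p D f).natAbs : ℕ) + 1

/-- The upper edge of the top layer `β_hi := nℓ`. [this work] -/
def βhi : ℤ := (nL κ Φ t p D f : ℤ) * ℓL κ Φ t p D f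

/-- **The transverse reading term** `Trd x B := ⌊c₀·(800·(m·x − B)/n)/D⌋` (the shape of (C-N3)'s `coarseSkel_zero_sub_bounds_signed`). [this work] -/
def Trd (x B : ℤ) : ℤ := (c0 κ Φ t p D f * (800 * (md κ Φ t p D f * x - B) / (nL κ Φ t p D f : ℤ))) / Dd κ Φ t p D f

/-- The along reading of the far edge `⌊c₁·800·β_hi/D⌋`. [this work] -/
def aHi : ℤ := (c1 κ Φ t p D f * (800 * βhi κ Φ t p D f)) / Dd κ Φ t p D f

/-- The along reading of the near edge `⌊c₁·800·β_lo/D⌋`. [this work] -/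
def aLo : ℤ := (c1 κ Φ t p D f * (800 * βlo κ Φ t p D f)) / Dd κ Φ t p D f

/-- `min (vα·β_lo) (vα·β_hi)` (frame `+1`). [folklore] -/
def Bmin : ℤ := min (vL κ Φ t p D f * βlo κ Φ t p D f) (vL κ Φ t p D f * βhi κ Φ t p D f)

/-- `max (vα·β_lo) (vα·β_hi)` (frame `+1`). [folklore] -/
def Bmax : ℤ := max (vL κ Φ t p D f * βlo κ Φ t p D f) (vL κ Φ t p D f * βhi κ Φ t p D f)

/-- `min (vα·(−β_hi)) (vα·(−β_lo))` (frame `−1`). [folklore] -/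
def Bmin' : ℤ := min (vL κ Φ t p D f * -βhi κ Φ t p D f) (vL κ Φ t p D f * -βlo κ Φ t p D f)

/-- `max (vα·(−β_hi)) (vα·(−β_lo))` (frame `−1`). [folklore] -/
def Bmax' : ℤ := max (vL κ Φ t p D f * -βhi κ Φ t p D f) (vL κ Φ t p D f * -βlo κ Φ t p D f)

/-- `max (−L·s_lo) …`: the maximal along progress `sHi := aHi + 1`. [this work] -/
def sHiC : ℤ := aHi κ Φ t p D f + 1

/-- The minimal along progress `sLo := aLo − 1`. [this work] -/
def sLoC : ℤ := aLo κ Φ t p D f - 1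

/-- The `τ = +1` piece length `Pp := max (Trd n Bmin + 1) (−Trd (−n) Bmax′)` (as a natural). [this work] -/
def PpC : ℕ := (max (Trd κ Φ t p D f (nL κ Φ t p D f) (Bmin κ Φ t p D f) + 1) (-Trd κ Φ t p D f (-(nL κ Φ t p D f : ℤ)) (Bmax' κ Φ t p D f))).toNat

/-- The `τ = −1` piece length `Pm := max (−Trd (−n) Bmax) (Trd n Bmin′ + 1)`. [this work] -/
def PmC : ℕ := (max (-Trd κ Φ t p D f (-(nL κ Φ t p D f : ℤ)) (Bmax κ Φ t p D f)) (Trd κ Φ t p D f (nL κ Φ t p D f) (Bmin' κ Φ t p D f) + 1)).toNat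

/-- **The floor slack of the readings** `z := max {Trd v Bmin + 1, Trd (−v) Bmin′ + 1, −Trd v Bmax, −Trd (−v) Bmax′}` (O(1): at the split point `v = v_α` the numerators cancel to
`v_α·(m − nℓ)`-type terms). [this work] -/
def zC : ℕ :=
  (max (max (Trd κ Φ t p D f (vL κ Φ t p D f) (Bmin κ Φ t p D f) + 1) (Trd κ Φ t p D f (-vL κ Φ t p D f) (Bmin' κ Φ t p D f) + 1))
    (max (-Trd κ Φ t p D f (vL κ Φ t p D f) (Bmax κ Φ t p D f)) (-Trd κ Φ t p D f (-vL κ Φ t p D f) (Bmax' κ Φ t p D f)))).toNat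

/-- **The siting slack per round** `e := z + R′` (reading slack + kit level depth; the schedule's enlargement is `R′ = e − z`, p5-g8 15:15:39Z (2)). [this work] -/
def eC : ℕ := zC κ Φ t p D f + R' κ Φ t p D

/-- The along half-size of the link box `La := max sHi (⌊c₁·800·3β_hi/D⌋ + 1)`. [this work] -/
def LaC : ℕ := (max (sHiC κ Φ t p D f) ((c1 κ Φ t p D f * (800 * (3 * βhi κ Φ t p D f))) / Dd κ Φ t p D f + 1)).toNat

/-- The transverse half-size of the link box `Lb := ⌊c₀·800·(|m|·n + |vα|·3β_hi)/(n·D)⌋ + 1`. [this work] -/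
def LbC : ℕ :=
  ((c0 κ Φ t p D f * (800 * (|md κ Φ t p D f| * nL κ Φ t p D f + |vL κ Φ t p D f| * (3 * βhi κ Φ t p D f)))) / ((nL κ Φ t p D f : ℤ) * Dd κ Φ t p D f) + 1).toNat

/-- The transverse half-window `W := max (3·r₀) (max Pp Pm + z)` (arrival box `M ⊆ core 0`, p5-g8 15:15:39Z (3)). [this work] -/
def WC : ℕ := max (3 * (fcells κ Φ t p D f).r 0) (max (PpC κ Φ t p D f) (PmC κ Φ t p D f) + zC κ Φ t p D f)

/-- The along half-width of core `0`: `L0 := 3·r₁`. [this work] -/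
def L0C : ℕ := 3 * (fcells κ Φ t p D f).r 1

/-- **The number of rounds** `N := ⌊(3r₁ − sHi)/(sLo − e)⌋₊ + 1` (so that `L0 ≤ sHi + (N+1)(sLo − e)` once `sLo > e`, p5-g8 15:15:39Z (4)). [this work] -/
def NC : ℕ := (((L0C κ Φ t p D f : ℤ) - sHiC κ Φ t p D f) / (sLoC κ Φ t p D f - eC κ Φ t p D f)).toNat + 1

/-- **THE PHASE-1 LOCALISATION RECORD OF RECORD** (signed v-rounds over the fine cell map, cell axis `1`). [cite: KozmaNitzan2024, §4 Lemma 12 (pp. 23–25)] -/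
def locPrm₁ : ChainPara.LocPrm :=
  ⟨sLoC κ Φ t p D f, sHiC κ Φ t p D f, PpC κ Φ t p D f, PmC κ Φ t p D f, WC κ Φ t p D f, eC κ Φ t p D f, LaC κ Φ t p D f, LbC κ Φ t p D f,
    L0C κ Φ t p D f, NC κ Φ t p D f⟩

/-! ## §2 The fifteen hypotheses of (C-N8) by name -/

/-- The record's fields, unfolded. [folklore] -/
theorem locPrm₁_fields :
    (locPrm₁ κ Φ t p D f).sLo = sLoC κ Φ t p D f ∧ (locPrm₁ κ Φ t p D f).sHi = sHiC κ Φ t p D f ∧ (locPrm₁ κ Φ t p D f).Pp = PpC κ Φ t p D f ∧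
      (locPrm₁ κ Φ t p D f).Pm = PmC κ Φ t p D f ∧ (locPrm₁ κ Φ t p D f).W = WC κ Φ t p D f ∧ (locPrm₁ κ Φ t p D f).e = eC κ Φ t p D f ∧
      (locPrm₁ κ Φ t p D f).La = LaC κ Φ t p D f ∧ (locPrm₁ κ Φ t p D f).Lb = LbC κ Φ t p D f ∧ (locPrm₁ κ Φ t p D f).L0 = L0C κ Φ t p D f ∧
      (locPrm₁ κ Φ t p D f).N = NC κ Φ t p D f :=
  ⟨rfl, rfl, rfl, rfl, rfl, rfl, rfl, rfl, rfl, rfl⟩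

/-- `D > 0` under the numeric long clause. [folklore] -/
theorem Dd_pos (hN : EqNumL κ Φ t p D f) : 0 < Dd κ Φ t p D f := by
  obtain ⟨hn1, hℓ1⟩ := one_le_of_eqNumL κ Φ t p D f hN
  exact Skelφ.NegPrm.Dof_pos hn1 hℓ1 _ _

/-- `0 ≤ c₀` and `0 ≤ c₁`. [folklore] -/
theorem c_nonneg' : 0 ≤ c0 κ Φ t p D f ∧ 0 ≤ c1 κ Φ t p D f := by unfold c0 c1; constructor <;> positivity

/-- `⌊X/D⌋ + 1` dominates `X/D`: `X ≤ (X/D + 1)·D` for `D > 0` (the shape of `hLa`/`hLb`). [folklore] -/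
theorem le_ediv_add_one_mul {X Dv : ℤ} (hD : 0 < Dv) : X ≤ (X / Dv + 1) * Dv := (Int.lt_ediv_add_one_mul_self X hD).le

/-- **`hsHi`**: `⌊c₁·(A·nℓ)/D⌋ + 1 ≤ sHi` (equality). [folklore] -/
theorem hsHi_at : (c1 κ Φ t p D f * (800 * ((nL κ Φ t p D f : ℤ) * ℓL κ Φ t p D f))) / Dd κ Φ t p D f + 1 ≤ (locPrm₁ κ Φ t p D f).sHi := le_rfl

/-- **`hsLo`**: `sLo + 1 ≤ ⌊c₁·(A·(nℓ − (n+|h|) + 1))/D⌋` (equality). [folklore] -/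
theorem hsLo_at : (locPrm₁ κ Φ t p D f).sLo + 1 ≤
    (c1 κ Φ t p D f * (800 * ((nL κ Φ t p D f : ℤ) * ℓL κ Φ t p D f - (nL κ Φ t p D f + (hL κ Φ t p D f).natAbs : ℕ) + 1))) / Dd κ Φ t p D f := by
  show sLoC κ Φ t p D f + 1 ≤ _
  unfold sLoC aLo βlo
  omega

/-- **`hp₁`**: `Trd n Bmin + 1 ≤ Pp`. [folklore] -/
theorem hp₁_at : Trd κ Φ t p D f (nL κ Φ t p D f) (Bmin κ Φ t p D f) + 1 ≤ ((locPrm₁ κ Φ t p D f).Pp : ℤ) := by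
  show _ ≤ ((PpC κ Φ t p D f : ℕ) : ℤ)
  unfold PpC
  exact (le_max_left _ _).trans (Int.self_le_toNat _)

/-- **`hp₂`**: `−Pp ≤ Trd (−n) Bmax′`. [folklore] -/
theorem hp₂_at : -((locPrm₁ κ Φ t p D f).Pp : ℤ) ≤ Trd κ Φ t p D f (-(nL κ Φ t p D f : ℤ)) (Bmax' κ Φ t p D f) := by
  show -((PpC κ Φ t p D f : ℕ) : ℤ) ≤ _
  unfold PpC
  have := (le_max_right (Trd κ Φ t p D f (nL κ Φ t p D f) (Bmin κ Φ t p D f) + 1) _).trans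
    (Int.self_le_toNat (max (Trd κ Φ t p D f (nL κ Φ t p D f) (Bmin κ Φ t p D f) + 1) (-Trd κ Φ t p D f (-(nL κ Φ t p D f : ℤ)) (Bmax' κ Φ t p D f))))
  linarith

/-- **`hm₁`**: `−Pm ≤ Trd (−n) Bmax`. [folklore] -/
theorem hm₁_at : -((locPrm₁ κ Φ t p D f).Pm : ℤ) ≤ Trd κ Φ t p D f (-(nL κ Φ t p D f : ℤ)) (Bmax κ Φ t p D f) := by
  show -((PmC κ Φ t p D f : ℕ) : ℤ) ≤ _
  unfold PmC
  have := (le_max_left (-Trd κ Φ t p D f (-(nL κ Φ t p D f : ℤ)) (Bmax κ Φ t p D f)) _).trans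
    (Int.self_le_toNat (max (-Trd κ Φ t p D f (-(nL κ Φ t p D f : ℤ)) (Bmax κ Φ t p D f)) (Trd κ Φ t p D f (nL κ Φ t p D f) (Bmin' κ Φ t p D f) + 1)))
  linarith

/-- **`hm₂`**: `Trd n Bmin′ + 1 ≤ Pm`. [folklore] -/
theorem hm₂_at : Trd κ Φ t p D f (nL κ Φ t p D f) (Bmin' κ Φ t p D f) + 1 ≤ ((locPrm₁ κ Φ t p D f).Pm : ℤ) := by
  show _ ≤ ((PmC κ Φ t p D f : ℕ) : ℤ)
  unfold PmC
  exact (le_max_right _ _).trans (Int.self_le_toNat _)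

/-- **`hz₂`**: `Trd v Bmin + 1 ≤ z`. [folklore] -/
theorem hz₂_at : Trd κ Φ t p D f (vL κ Φ t p D f) (Bmin κ Φ t p D f) + 1 ≤ (zC κ Φ t p D f : ℤ) := by
  unfold zC
  exact ((le_max_left _ _).trans (le_max_left _ _)).trans (Int.self_le_toNat _)

/-- **`hz₃`**: `Trd (−v) Bmin′ + 1 ≤ z`. [folklore] -/
theorem hz₃_at : Trd κ Φ t p D f (-vL κ Φ t p D f) (Bmin' κ Φ t p D f) + 1 ≤ (zC κ Φ t p D f : ℤ) := by
  unfold zC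
  exact ((le_max_right _ _).trans (le_max_left _ _)).trans (Int.self_le_toNat _)

/-- **`hz₁`**: `−z ≤ Trd v Bmax`. [folklore] -/
theorem hz₁_at : -(zC κ Φ t p D f : ℤ) ≤ Trd κ Φ t p D f (vL κ Φ t p D f) (Bmax κ Φ t p D f) := by
  unfold zC
  have := ((le_max_left (-Trd κ Φ t p D f (vL κ Φ t p D f) (Bmax κ Φ t p D f)) _).trans (le_max_right _ _)).trans
    (Int.self_le_toNat (max (max (Trd κ Φ t p D f (vL κ Φ t p D f) (Bmin κ Φ t p D f) + 1) (Trd κ Φ t p D f (-vL κ Φ t p D f) (Bmin' κ Φ t p D f) + 1))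
      (max (-Trd κ Φ t p D f (vL κ Φ t p D f) (Bmax κ Φ t p D f)) (-Trd κ Φ t p D f (-vL κ Φ t p D f) (Bmax' κ Φ t p D f)))))
  linarith

/-- **`hz₄`**: `−z ≤ Trd (−v) Bmax′`. [folklore] -/
theorem hz₄_at : -(zC κ Φ t p D f : ℤ) ≤ Trd κ Φ t p D f (-vL κ Φ t p D f) (Bmax' κ Φ t p D f) := by
  unfold zC
  have := ((le_max_right _ (-Trd κ Φ t p D f (-vL κ Φ t p D f) (Bmax' κ Φ t p D f))).trans (le_max_right _ _)).trans
    (Int.self_le_toNat (max (max (Trd κ Φ t p D f (vL κ Φ t p D f) (Bmin κ Φ t p D f) + 1) (Trd κ Φ t p D f (-vL κ Φ t p D f) (Bmin' κ Φ t p D f) + 1))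
      (max (-Trd κ Φ t p D f (vL κ Φ t p D f) (Bmax κ Φ t p D f)) (-Trd κ Φ t p D f (-vL κ Φ t p D f) (Bmax' κ Φ t p D f)))))
  linarith

/-- **`hz`**: `z ≤ e`. [folklore] -/
theorem hz_at : zC κ Φ t p D f ≤ (locPrm₁ κ Φ t p D f).e := Nat.le_add_right _ _

/-- `e = z + R′`: the schedule's enlargement `e − z` is the kit radius `R′`. [folklore] -/
theorem e_sub_z : (locPrm₁ κ Φ t p D f).e - zC κ Φ t p D f = R' κ Φ t p D := by
  show eC κ Φ t p D f - zC κ Φ t p D f = _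
  unfold eC; omega

/-- **`hzP`**: `Pp + z ≤ W`. [folklore] -/
theorem hzP_at : ((locPrm₁ κ Φ t p D f).Pp : ℤ) + zC κ Φ t p D f ≤ (locPrm₁ κ Φ t p D f).W := by
  show ((PpC κ Φ t p D f : ℕ) : ℤ) + zC κ Φ t p D f ≤ ((WC κ Φ t p D f : ℕ) : ℤ)
  have : PpC κ Φ t p D f + zC κ Φ t p D f ≤ WC κ Φ t p D f := by
    unfold WC; exact le_max_of_le_right (Nat.add_le_add_right (le_max_left _ _) _)
  exact_mod_cast this

/-- **`hzM`**: `Pm + z ≤ W`. [folklore] -/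
theorem hzM_at : ((locPrm₁ κ Φ t p D f).Pm : ℤ) + zC κ Φ t p D f ≤ (locPrm₁ κ Φ t p D f).W := by
  show ((PmC κ Φ t p D f : ℕ) : ℤ) + zC κ Φ t p D f ≤ ((WC κ Φ t p D f : ℕ) : ℤ)
  have : PmC κ Φ t p D f + zC κ Φ t p D f ≤ WC κ Φ t p D f := by
    unfold WC; exact le_max_of_le_right (Nat.add_le_add_right (le_max_right _ _) _)
  exact_mod_cast this

/-- **`h3r₀`**: `3·r₀ ≤ W` (the arrival box of a cell lies in core `0`). [folklore] -/
theorem h3r₀_at : 3 * (fcells κ Φ t p D f).r 0 ≤ (locPrm₁ κ Φ t p D f).W := le_max_left _ _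

/-- **`L0 = 3·r₁`**. [folklore] -/
theorem L0_eq : (locPrm₁ κ Φ t p D f).L0 = 3 * (fcells κ Φ t p D f).r 1 := rfl

/-- **`hLa`**: `c₁·(|A|·3nℓ) ≤ La·D` under the numeric long clause. [folklore] -/
theorem hLa_at (hN : EqNumL κ Φ t p D f) :
    c1 κ Φ t p D f * (|(800 : ℤ)| * (3 * ((nL κ Φ t p D f : ℤ) * ℓL κ Φ t p D f))) ≤ ((locPrm₁ κ Φ t p D f).La : ℤ) * Dd κ Φ t p D f := by
  have hD := Dd_pos κ Φ t p D f hN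
  have e8 : |(800 : ℤ)| = 800 := abs_of_nonneg (by norm_num)
  rw [e8]
  set X : ℤ := c1 κ Φ t p D f * (800 * (3 * ((nL κ Φ t p D f : ℤ) * ℓL κ Φ t p D f))) with hX
  have hLa : X / Dd κ Φ t p D f + 1 ≤ ((locPrm₁ κ Φ t p D f).La : ℤ) := by
    show _ ≤ ((LaC κ Φ t p D f : ℕ) : ℤ)
    unfold LaC
    refine le_trans ?_ (Int.self_le_toNat _)
    have : X = c1 κ Φ t p D f * (800 * (3 * βhi κ Φ t p D f)) := by rw [hX]; unfold βhi; ring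
    rw [this]
    exact le_max_right _ _
  calc X ≤ (X / Dd κ Φ t p D f + 1) * Dd κ Φ t p D f := le_ediv_add_one_mul hD
    _ ≤ ((locPrm₁ κ Φ t p D f).La : ℤ) * Dd κ Φ t p D f := mul_le_mul_of_nonneg_right hLa hD.le

/-- **`hLb`**: `c₀·(|A|·(|m|·n + |vα|·3nℓ)) ≤ Lb·(n·D)` under the numeric long clause. [folklore] -/
theorem hLb_at (hN : EqNumL κ Φ t p D f) :
    c0 κ Φ t p D f * (|(800 : ℤ)| * (|md κ Φ t p D f| * nL κ Φ t p D f + |vL κ Φ t p D f| * (3 * ((nL κ Φ t p D f : ℤ) * ℓL κ Φ t p D f)))) ≤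
      ((locPrm₁ κ Φ t p D f).Lb : ℤ) * ((nL κ Φ t p D f : ℤ) * Dd κ Φ t p D f) := by
  have hD := Dd_pos κ Φ t p D f hN
  have hn1 : (1 : ℤ) ≤ nL κ Φ t p D f := by exact_mod_cast (one_le_of_eqNumL κ Φ t p D f hN).1
  have hnD : 0 < (nL κ Φ t p D f : ℤ) * Dd κ Φ t p D f := by positivity
  have e8 : |(800 : ℤ)| = 800 := abs_of_nonneg (by norm_num)
  rw [e8]
  set X : ℤ := c0 κ Φ t p D f * (800 * (|md κ Φ t p D f| * nL κ Φ t p D f + |vL κ Φ t p D f| * (3 * ((nL κ Φ t p D f : ℤ) * ℓL κ Φ t p D f)))) with hX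
  have hLb : X / ((nL κ Φ t p D f : ℤ) * Dd κ Φ t p D f) + 1 ≤ ((locPrm₁ κ Φ t p D f).Lb : ℤ) := by
    show _ ≤ ((LbC κ Φ t p D f : ℕ) : ℤ)
    unfold LbC
    refine le_trans (le_of_eq ?_) (Int.self_le_toNat _)
    rw [hX]; unfold βhi; rfl
  calc X ≤ (X / ((nL κ Φ t p D f : ℤ) * Dd κ Φ t p D f) + 1) * ((nL κ Φ t p D f : ℤ) * Dd κ Φ t p D f) := le_ediv_add_one_mul hnD
    _ ≤ ((locPrm₁ κ Φ t p D f).Lb : ℤ) * ((nL κ Φ t p D f : ℤ) * Dd κ Φ t p D f) := mul_le_mul_of_nonneg_right hLb hnD.le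

/-! ## §3 The definitional `LocOK` fields and the rounds inequality -/

/-- `β_lo ≤ β_hi` (`n + |h| ≥ 1`). [folklore] -/
theorem βlo_le_βhi (hN : EqNumL κ Φ t p D f) : βlo κ Φ t p D f ≤ βhi κ Φ t p D f := by
  unfold βlo βhi
  have h1 : 1 ≤ nL κ Φ t p D f + (hL κ Φ t p D f).natAbs := le_add_right (one_le_of_eqNumL κ Φ t p D f hN).1
  have : (1 : ℤ) ≤ ((nL κ Φ t p D f + (hL κ Φ t p D f).natAbs : ℕ) : ℤ) := by exact_mod_cast h1
  linarith

/-- `aLo ≤ aHi` (monotone floor; `c₁ ≥ 0`, `D > 0`). [folklore] -/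
theorem aLo_le_aHi (hN : EqNumL κ Φ t p D f) : aLo κ Φ t p D f ≤ aHi κ Φ t p D f := by
  have hD := Dd_pos κ Φ t p D f hN
  have hc := (c_nonneg' κ Φ t p D f).2
  unfold aLo aHi
  exact Int.ediv_le_ediv hD (mul_le_mul_of_nonneg_left (by linarith [βlo_le_βhi κ Φ t p D f hN]) hc)

/-- **`LocOK.hs`**: `sLo ≤ sHi`. [folklore] -/
theorem locOK_hs (hN : EqNumL κ Φ t p D f) : (locPrm₁ κ Φ t p D f).sLo ≤ (locPrm₁ κ Φ t p D f).sHi := by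
  show sLoC κ Φ t p D f ≤ sHiC κ Φ t p D f
  unfold sLoC sHiC
  linarith [aLo_le_aHi κ Φ t p D f hN]

/-- **`LocOK.hsL`**: `sHi ≤ La`. [folklore] -/
theorem locOK_hsL : (locPrm₁ κ Φ t p D f).sHi ≤ (locPrm₁ κ Φ t p D f).La := by
  show sHiC κ Φ t p D f ≤ ((LaC κ Φ t p D f : ℕ) : ℤ)
  unfold LaC
  exact (le_max_left _ _).trans (Int.self_le_toNat _)

/-- **`LocOK.hPp`** and **`LocOK.hPm`**: both pieces fit in the window. [folklore] -/
theorem locOK_hP : (locPrm₁ κ Φ t p D f).Pp ≤ (locPrm₁ κ Φ t p D f).W ∧ (locPrm₁ κ Φ t p D f).Pm ≤ (locPrm₁ κ Φ t p D f).W := by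
  constructor
  · show PpC κ Φ t p D f ≤ WC κ Φ t p D f
    unfold WC; exact le_max_of_le_right ((le_max_left _ _).trans (Nat.le_add_right _ _))
  · show PmC κ Φ t p D f ≤ WC κ Φ t p D f
    unfold WC; exact le_max_of_le_right ((le_max_right _ _).trans (Nat.le_add_right _ _))

/-- **`LocOK` from its two estimate fields**: given `0 ≤ sLo` and `e ≤ sLo` (part 5b), the record is admissible. [folklore] -/
theorem locOK_of (hN : EqNumL κ Φ t p D f) (hs0 : 0 ≤ (locPrm₁ κ Φ t p D f).sLo) (he : ((locPrm₁ κ Φ t p D f).e : ℤ) ≤ (locPrm₁ κ Φ t p D f).sLo) :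
    ChainPara.LocOK (locPrm₁ κ Φ t p D f) :=
  ⟨hs0, locOK_hs κ Φ t p D f hN, locOK_hsL κ Φ t p D f, (locOK_hP κ Φ t p D f).1, (locOK_hP κ Φ t p D f).2, he⟩

/-- **The rounds inequality `hN`**: `L0 ≤ sHi + (N+1)·(sLo − e)` as soon as `e < sLo` (one stride of net progress per round). [folklore] -/
theorem hN_at (he : ((locPrm₁ κ Φ t p D f).e : ℤ) < (locPrm₁ κ Φ t p D f).sLo) :
    ((locPrm₁ κ Φ t p D f).L0 : ℤ) ≤ (locPrm₁ κ Φ t p D f).sHi + (((locPrm₁ κ Φ t p D f).N : ℕ) + 1 : ℤ) * ((locPrm₁ κ Φ t p D f).sLo - (locPrm₁ κ Φ t p D f).e) := by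
  show ((L0C κ Φ t p D f : ℕ) : ℤ) ≤ sHiC κ Φ t p D f + (((NC κ Φ t p D f : ℕ) : ℤ) + 1) * (sLoC κ Φ t p D f - ((eC κ Φ t p D f : ℕ) : ℤ))
  have hd : 0 < sLoC κ Φ t p D f - ((eC κ Φ t p D f : ℕ) : ℤ) := by
    have : ((eC κ Φ t p D f : ℕ) : ℤ) < sLoC κ Φ t p D f := he
    linarith
  set d := sLoC κ Φ t p D f - ((eC κ Φ t p D f : ℕ) : ℤ) with hdd
  set Y := ((L0C κ Φ t p D f : ℕ) : ℤ) - sHiC κ Φ t p D f with hY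
  have hNC : ((NC κ Φ t p D f : ℕ) : ℤ) = ((Y / d).toNat : ℤ) + 1 := by
    unfold NC; push_cast; rw [← hY, ← hdd]
  rw [hNC]
  -- `Y ≤ (⌊Y/d⌋₊ + 2)·d` : from `Y < (Y/d + 1)·d ≤ (toNat (Y/d) + 1)·d`
  have h1 : Y ≤ (Y / d + 1) * d := le_ediv_add_one_mul hd
  have h2 : Y / d ≤ ((Y / d).toNat : ℤ) := Int.self_le_toNat _
  nlinarith

end CorrLevel

end Neg

end PlanarSkeletonNeg

end Summit.CriticalPhenomena.PercolationContinuityZ3.Theorems.Transplant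

end
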